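import Summits.SmoothPoincare4.SmoothPoincare4.Theses.InstantonEntropy
import Literature.Geometry.Riemannian.ChangGurskyYangProofs
import Literature.Topology.FourManifolds.HomotopyS4CompactProofs
import HarnessLib

/-!
# Line `birth` — BC3 skeleton for the crux `InstantonEntropy.ExistRicPos` (stmt-SmoothPoincare4-11180)

Route `route-SmoothPoincare4-InstantonEntropy` (rank-4 crux), decl
`Summit.SmoothPoincare4.SmoothPoincare4.Theses.InstantonEntropy.ExistRicPos`:

  every smooth homotopy 4-sphere `M` (Hausdorff, second countable, `C^∞` atlas on `ℝ⁴`,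
  `M ≃ₕ S⁴` — the bare carriers of `SmoothPoincare4`) carries a `C^∞` Riemannian metric `g`
  (with its Levi-Civita connection) of pointwise POSITIVE RICCI CURVATURE.

Standing of the crux (item evidence, refuters 2026-08-15): `SmoothPoincare4 → ExistRicPos` is
PROVED (pull back the round metric), the converse is open; the crux is one mathematical statement
with `MinimalSphereMeanConvex.RicciPositiveMetric` (stmt-5487). No `Disproof.lean`, no landed
`Theorems/ExistRicPos/Negative/*`, negatives index of the summit empty (2026-08-17).

## The line: Chang–Gursky–Yang's σ₂-conformal route to `Ric > 0` (Ann. of Math. 155 (2002))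

Chang–Gursky–Yang 2002 (arXiv:math/0409583; pages read: pp. 2–6 of the arXiv text), verbatim:
"**Theorem A.** Let `(M⁴, g₀)` be a compact four-manifold satisfying (i) `∫σ₂(A₀) dv₀ > 0` and
(ii) `Y(g₀) > 0`. Then there is a conformal metric `g = e^{2w} g₀` with `σ₂(A_g) > 0`."
"**Corollary B.** Under the assumptions of Theorem A, there is a conformal metric `g = e^{2w} g₀`
with (i) `Ric > 0`, (ii) `S = −Ric + ½Rg > 0`." Here `A = Ric − (1/6)R g`, `σ₂(A) = −½|E|² +
R²/24` (`E` the traceless Ricci tensor), and Corollary B is Theorem A plus the pointwise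
"**Lemma 1.2.** If the scalar curvature `R` of `g` is positive at `P`, then
`Ric(X,X) ≥ (3σ₂(A)/R)|X|²`" (proof: `Ric = E + ¼Rg` and the sharp inequality
`|E(X,X)| ≤ (√3/2)|E||X|²` for traceless `E`, [SW, p. 234]; then
`R/4 − (√3/2)|E| − 3σ₂(A)/R = (R − 2√3|E|)²/(8R) ≥ 0`).

So `Ric > 0` on a homotopy 4-sphere `Σ` follows from ONE conformally invariant integral inequality
on a positive-scalar-curvature metric. In the tree's vocabulary (`PseudoRiemannianMetric.{ricci,
scalarCurvature}` of `Lorentzian/LeviCivita.lean`; `sigma2WeylSchouten` = `σ₂(A_g)(x)` and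
`sigma2WeylSchoutenIntegral` = `∫_M σ₂(A_g) dV_g` of `Riemannian/ChangGurskyYangProofs.lean`, CGY's
normalisation (1.0)–(1.2)):

* `stub_sigma2BudgetPsc` — **OPEN, the hard stub (crux-hard):** every smooth homotopy 4-sphere
  carries a `C^∞` Riemannian metric `g` with `R_g > 0` everywhere and `∫ σ₂(A_g) dV_g > 0`.
  Two readings: (a) since `σ₂(A) = R²/24 − ½|E|²` it asks for a PSC metric that is ALMOST
  EINSTEIN IN `L²`: `∫|Ric − ¼Rg|² dV < (1/12)∫R² dV` — an integral pinching, which may hold while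
  `Ric` is very negative somewhere (the conformal freedom of stub 2 repairs that); (b) by the
  Chern–Gauss–Bonnet formula `8π²χ = ¼∫|W|² + ∫σ₂(A)` (tree THEOREM `chernGaussBonnet_four_holds`)
  and `χ(Σ) = 2` it asks for a PSC metric with WEYL ENERGY `∫|W|² dV < 64π²` — exactly TWICE the
  budget `32π²` of the sphere theorem (Chang–Gursky–Yang 2003 Thm. A; route `WeylBudget`, item
  `WeylLight` = stmt-10830, which is `⇔ SPC4` modulo that theorem). So this stub sits strictly
  between PSC-existence on homotopy 4-spheres (`BachCriticalElement.PscOnHomotopySpheres`,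
  stmt-4393, any Weyl energy) and `WeylLight` (`< 32π²`): it is implied by `SPC4` (round metric:
  `W = 0`, `σ₂(A) = 6`), implies `ExistRicPos` (this file), and is NOT known to imply `SPC4`
  (an exotic `Σ` with a PSC metric of Weyl energy in `[32π², 64π²)` is consistent with everything
  known). Why it might fail: an exotic `Σ` may carry no PSC metric at all (open; only up to
  homeomorphism, cf. the `WeylBudget` docstrings), or every PSC conformal class on it may be
  Weyl-heavy (`∫|W|² ≥ 64π²`: Gursky-type lower bounds `∫|W|² ≥ c·χ` are known only WITH
  `b₂⁺`-type hypotheses, vacuous here). Sources: ChangGurskyYang2002 (doi:10.2307/3062131,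
  arXiv:math/0409583) Thm. A/Cor. B and §8; ChangGurskyYang2003 (arXiv:math/0309287) Thm. A;
  Gursky1998. Size: open problem (the crux's own difficulty, transported to a scalar, conformally
  invariant, variational target: minimise `∫|W|²` over Yamabe-positive classes of `Σ`).
* `stub_changGurskyYangThmA` — **KNOWN, deep (to be vendored as a named fact):** CGY 2002
  Theorem A in the PSC special case (`R_{g} > 0` pointwise gives `Y(M,[g]) > 0` on a closed
  manifold, Lee–Parker 1987 (1.5)/Thm. 2.2 — the same reduction the tree's fact
  `changGurskyYang_sphere_four` uses) and in the form the printed proof delivers (p. 4: "(0.7)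
  admits a smooth solution with positive scalar curvature … perturbed [by the Yamabe flow] to give
  metrics with `σ₂(A) > 0`"; `R ≠ 0` of constant sign under `σ₂(A) > 0`, Lemma 1.1/Cor. 1.4, and
  `> 0` in a Yamabe-positive class): on a compact CONNECTED smooth 4-manifold, a `C^∞` Riemannian
  metric `g` with `R_g > 0` and `∫σ₂(A_g) dV_g > 0` is conformal (`g' = e^{2w} g`, `w` smooth) to
  a `C^∞` Riemannian metric with `R_{g'} > 0` and `σ₂(A_{g'}) > 0` POINTWISE. Connectedness is
  load-bearing: on `S⁴_round ⊔ (S³ × S¹)_prod` one has `R > 0`, `∫σ₂(A) = ∫_{S⁴} 6 dV + 0 > 0`,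
  and no metric with `Ric > 0` on the second component (Bonnet–Myers). Why it might fail: it is
  a published theorem; the risks are vendoring fidelity only (`C^∞` regularity of `w`; the tree's
  `sigma2WeylSchouten` is the sup-over-orthonormal-frames definition, equal to `−½|E|² + R²/24` by
  `sigma2WeylSchouten_eq`). Size: XL (fully nonlinear Monge–Ampère-type PDE, fourth-order
  regularisation via the log-determinant functional, Yamabe flow) — far from formalisable; a lead
  closes it modulo a named fact `Literature.Geometry.Riemannian.changGurskyYang_sigma2_conformal_four`
  (to be filed).
* `stub_ricciLowerBound` — **KNOWN, elementary (provable now, size M):** CGY 2002 Lemma 1.2 over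
  the tree's definitions: for a `C^∞` Riemannian metric on a 4-manifold modelled on `ℝ⁴`, at a point
  with `R > 0`, `Ric(v,v) ≥ (3σ₂(A)/R)·g(v,v)` for every tangent vector `v`. Ingredients in the
  tree: `sigma2WeylSchouten_eq` (`σ₂ = −½|E|² + R²/24`), orthonormal frames
  (`exists_basis_isOrthonormalFrame`), `ricci_symm_holds`; missing: the traceless eigenvalue bound
  `|E(v,v)| ≤ (√3/2)|E| g(v,v)` (Cauchy–Schwarz on the trace-zero hyperplane of `ℝ⁴`).
* `ExistRicPos_of_stubSigs : stub₁-sig → stub₂-sig → stub₃-sig → ExistRicPos` — the REAL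
  composition (sorry-free, standard axioms): `M ≃ₕ S⁴` makes `M` compact
  (`compactSpace_of_homotopyEquiv_sphere_four_holds`, PROVED, Hatcher 3.29) and path connected
  (`pathConnectedSpace_of_homotopyEquiv`, `pathConnectedSpace_sphere_four`); stub 1 gives the PSC
  metric with `∫σ₂ > 0`; stub 2 the conformal metric `g'` with `R' > 0`, `σ₂(A') > 0`; stub 3 and
  `g'(v,v) > 0` (`IsRiemannian`) give `Ric'(v,v) ≥ 3σ₂(A')/R' · g'(v,v) > 0` for `v ≠ 0`.
* `ExistRicPos_of : ExistRicPos` — THE skeleton theorem: the crux BY NAME from the three declared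
  stubs (the only `sorry`s of the file).

BC3 probes (planner folder `bc/probe_*.lean`, 2026-08-17): for each stub, `stub → ExistRicPos` and
`stub → SmoothPoincare4` by `first | exact? | simpa | aesop` FAIL (no stub is cheaply the crux or
the summit: stub 1 speaks of scalar curvature and `∫σ₂`, never of `Ric`; stubs 2–3 are conditional
statements about a GIVEN metric on an arbitrary compact/any 4-manifold). Logical status: `SPC4 ⇒`
each stub's instance on homotopy spheres; stub 2, stub 3 are theorems; stub 1 ⇒ crux (this file);
crux ⇏ stub 1 known. Disproof used: none exists for this crux (`ledger crux ls` empty).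
-/

noncomputable section

open scoped Manifold ContDiff Topology
open ContinuousMap
open Literature.Geometry.Lorentzian (PseudoRiemannianMetric)
open Literature.Geometry.Lorentzian.PseudoRiemannianMetric
open Literature.Topology.FourManifolds
open Summit.SmoothPoincare4.SmoothPoincare4.Theses.InstantonEntropy (ExistRicPos)

-- `Summit.<Summit>.<Problem>`: for the single-conjunct summit the duplicate segment is mandated.
set_option linter.dupNamespace false
set_option linter.unusedVariables false

namespace Summit.SmoothPoincare4.SmoothPoincare4.Cruxes.ExistRicPos.Birth

/-- Local notation: the standard `S⁴ ⊂ ℝ⁵`. -/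
local notation "𝕊⁴" => (Metric.sphere (0 : EuclideanSpace ℝ (Fin 5)) 1)

/-! ## The three registered stubs (`sorry` lives ONLY here) -/

/-- **Stub 1 (OPEN — the hard stub): a positive-scalar-curvature metric with positive total
`σ₂`-curvature on every smooth homotopy 4-sphere.** For every Hausdorff, second countable `C^∞`
4-manifold `M` modelled on `ℝ⁴` with `M ≃ₕ S⁴` there is a `C^∞` Riemannian metric `g` on `TM`
(with its Levi-Civita connection) with `R_g(x) > 0` at every point and
`∫_M σ₂(A_g) dV_g > 0`, `A_g = Ric − (R/6)g`, `σ₂(A) = −½|E|² + R²/24` (CGY's hypotheses (i)–(ii)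
of Theorem A with the Yamabe-positive class represented by a PSC member). Equivalently (Chern–
Gauss–Bonnet, `χ = 2`): a PSC metric of Weyl energy `∫|W|² dV < 64π²`, twice the sphere-theorem
budget of `WeylBudget.WeylLight`; equivalently an `L²`-almost-Einstein PSC metric,
`∫|E|² < (1/12)∫R²`. Implied by `SPC4` (round metric); implies the crux (`ExistRicPos_of`); not
known to imply `SPC4`. Why it might fail: an exotic `Σ` may admit no PSC metric, or only
Weyl-heavy PSC conformal classes (`∫|W|² ≥ 64π²`).
[cite: ChangGurskyYang2002, Thm. A, Cor. B, §8] [cite: ChangGurskyYang2003, Thm. A] -/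
theorem stub_sigma2BudgetPsc :
    ∀ (M : Type) [TopologicalSpace M] [T2Space M] [SecondCountableTopology M]
      [ChartedSpace (EuclideanSpace ℝ (Fin 4)) M] [IsManifold (𝓡 4) ∞ M],
      M ≃ₕ 𝕊⁴ →
        ∃ g : PseudoRiemannianMetric (𝓡 4) ∞ (EuclideanSpace ℝ (Fin 4))
            (TangentSpace (𝓡 4) : M → Type _),
          ∃ _ : g.HasLeviCivita, g.IsRiemannian ∧ (∀ x : M, 0 < g.scalarCurvature x) ∧
            0 < g.sigma2WeylSchoutenIntegral := by
  sorry

/-- **Stub 2 (KNOWN, deep — Chang–Gursky–Yang 2002, Theorem A, positive-scalar-curvature case):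
conformal deformation to `σ₂(A) > 0`.** "Let `(M⁴, g₀)` be a compact four-manifold satisfying (i)
`∫σ₂(A₀) dv₀ > 0` and (ii) `Y(g₀) > 0`. Then there is a conformal metric `g = e^{2w} g₀` with
`σ₂(A_g) > 0`" — here with (ii) witnessed by `R_{g₀} > 0` pointwise (which gives `Y > 0` on a
closed manifold, Lee–Parker 1987 (1.5)/Thm. 2.2) and with the positive scalar curvature of the
constructed metric recorded (CGY 2002 p. 4 and Lemma 1.1/Cor. 1.4: under `σ₂(A) > 0` the sign of
`R` is constant on the connected `M`, and positive in a Yamabe-positive class). Statement: on a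
compact connected Hausdorff second countable `C^∞` 4-manifold modelled on `ℝ⁴`, every `C^∞`
Riemannian metric `g` (with its Levi-Civita connection) with `R_g > 0` everywhere and
`∫_M σ₂(A_g) dV_g > 0` is pointwise conformal, `g' = e^{2w} g` with `w` smooth, to a `C^∞`
Riemannian metric `g'` with `R_{g'} > 0` and `σ₂(A_{g'}) > 0` at every point. `ConnectedSpace` is
load-bearing (`S⁴ ⊔ S³×S¹`). Why it might fail: published theorem — vendoring fidelity only.
[cite: ChangGurskyYang2002, Thm. A, Lemma 1.1, Cor. 1.4] [cite: LeeParker1987, (1.5), Thm. 2.2] -/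
theorem stub_changGurskyYangThmA :
    ∀ (M : Type) [TopologicalSpace M] [T2Space M] [SecondCountableTopology M]
      [ChartedSpace (EuclideanSpace ℝ (Fin 4)) M] [IsManifold (𝓡 4) ∞ M]
      [CompactSpace M] [ConnectedSpace M]
      (g : PseudoRiemannianMetric (𝓡 4) ∞ (EuclideanSpace ℝ (Fin 4))
        (TangentSpace (𝓡 4) : M → Type _)) [g.HasLeviCivita],
      g.IsRiemannian → (∀ x : M, 0 < g.scalarCurvature x) → 0 < g.sigma2WeylSchoutenIntegral →
        ∃ g' : PseudoRiemannianMetric (𝓡 4) ∞ (EuclideanSpace ℝ (Fin 4))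
            (TangentSpace (𝓡 4) : M → Type _),
          ∃ _ : g'.HasLeviCivita, g'.IsRiemannian ∧
            (∃ w : M → ℝ, ContMDiff (𝓡 4) 𝓘(ℝ) ∞ w ∧
              ∀ (x : M) (v u : TangentSpace (𝓡 4) x),
                g'.val x v u = Real.exp (2 * w x) * g.val x v u) ∧
            (∀ x : M, 0 < g'.scalarCurvature x) ∧ (∀ x : M, 0 < g'.sigma2WeylSchouten x) := by
  sorry

/-- **Stub 3 (KNOWN, elementary — Chang–Gursky–Yang 2002, Lemma 1.2): `σ₂(A)` bounds the Ricci
tensor from below in dimension four.** "Let `P ∈ M⁴` and `X ∈ T_P M⁴`. If the scalar curvature `R`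
of `g` is positive at `P`, then `Ric(X,X) ≥ (3σ₂(A)/R)|X|²`" (from `Ric = E + ¼Rg` and
`|E(X,X)| ≤ (√3/2)|E||X|²` for the traceless `E`, [SW, p. 234]:
`R/4 − (√3/2)|E| − 3σ₂(A)/R = (R − 2√3|E|)²/(8R) ≥ 0`). Stated over the tree's definitions
(`sigma2WeylSchouten` = `−½|E|² + R²/24` at Riemannian points, `sigma2WeylSchouten_eq`) for a
`C^∞` Riemannian metric with its Levi-Civita connection on a 4-manifold modelled on `ℝ⁴`.
Why it might fail: it does not (linear algebra); size M in Lean (orthonormal frame + the traceless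
eigenvalue bound). [cite: ChangGurskyYang2002, Lemma 1.2] -/
theorem stub_ricciLowerBound :
    ∀ (M : Type) [TopologicalSpace M] [T2Space M] [SecondCountableTopology M]
      [ChartedSpace (EuclideanSpace ℝ (Fin 4)) M] [IsManifold (𝓡 4) ∞ M]
      (g : PseudoRiemannianMetric (𝓡 4) ∞ (EuclideanSpace ℝ (Fin 4))
        (TangentSpace (𝓡 4) : M → Type _)) [g.HasLeviCivita],
      g.IsRiemannian → ∀ x : M, 0 < g.scalarCurvature x → ∀ v : TangentSpace (𝓡 4) x,
        3 * g.sigma2WeylSchouten x / g.scalarCurvature x * g.val x v v ≤ g.ricci x v v := by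
  sorry

/-! ## The composition: the three stubs prove the crux BY NAME (no `sorry` below this line) -/

/-- **Composition with explicit hypotheses** (the BC3 shape `stub₁-sig → stub₂-sig → stub₃-sig →
crux`): this is Corollary B of Chang–Gursky–Yang 2002 assembled from Theorem A and Lemma 1.2 on a
homotopy 4-sphere, which is compact (`compactSpace_of_homotopyEquiv_sphere_four_holds`, Hatcher
2002 Prop. 3.29) and path connected (`pathConnectedSpace_of_homotopyEquiv`): the PSC metric with
`∫σ₂ > 0` of stub 1 is conformally deformed by stub 2 to `g'` with `R' > 0`, `σ₂(A') > 0`, and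
stub 3 gives `Ric'(v,v) ≥ (3σ₂(A')/R')·g'(v,v) > 0` for `v ≠ 0` (`g'` Riemannian).
[cite: ChangGurskyYang2002, Cor. B] -/
theorem ExistRicPos_of_stubSigs
    (h₁ : ∀ (M : Type) [TopologicalSpace M] [T2Space M] [SecondCountableTopology M]
      [ChartedSpace (EuclideanSpace ℝ (Fin 4)) M] [IsManifold (𝓡 4) ∞ M],
      M ≃ₕ 𝕊⁴ →
        ∃ g : PseudoRiemannianMetric (𝓡 4) ∞ (EuclideanSpace ℝ (Fin 4))
            (TangentSpace (𝓡 4) : M → Type _),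
          ∃ _ : g.HasLeviCivita, g.IsRiemannian ∧ (∀ x : M, 0 < g.scalarCurvature x) ∧
            0 < g.sigma2WeylSchoutenIntegral)
    (h₂ : ∀ (M : Type) [TopologicalSpace M] [T2Space M] [SecondCountableTopology M]
      [ChartedSpace (EuclideanSpace ℝ (Fin 4)) M] [IsManifold (𝓡 4) ∞ M]
      [CompactSpace M] [ConnectedSpace M]
      (g : PseudoRiemannianMetric (𝓡 4) ∞ (EuclideanSpace ℝ (Fin 4))
        (TangentSpace (𝓡 4) : M → Type _)) [g.HasLeviCivita],
      g.IsRiemannian → (∀ x : M, 0 < g.scalarCurvature x) → 0 < g.sigma2WeylSchoutenIntegral →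
        ∃ g' : PseudoRiemannianMetric (𝓡 4) ∞ (EuclideanSpace ℝ (Fin 4))
            (TangentSpace (𝓡 4) : M → Type _),
          ∃ _ : g'.HasLeviCivita, g'.IsRiemannian ∧
            (∃ w : M → ℝ, ContMDiff (𝓡 4) 𝓘(ℝ) ∞ w ∧
              ∀ (x : M) (v u : TangentSpace (𝓡 4) x),
                g'.val x v u = Real.exp (2 * w x) * g.val x v u) ∧
            (∀ x : M, 0 < g'.scalarCurvature x) ∧ (∀ x : M, 0 < g'.sigma2WeylSchouten x))
    (h₃ : ∀ (M : Type) [TopologicalSpace M] [T2Space M] [SecondCountableTopology M]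
      [ChartedSpace (EuclideanSpace ℝ (Fin 4)) M] [IsManifold (𝓡 4) ∞ M]
      (g : PseudoRiemannianMetric (𝓡 4) ∞ (EuclideanSpace ℝ (Fin 4))
        (TangentSpace (𝓡 4) : M → Type _)) [g.HasLeviCivita],
      g.IsRiemannian → ∀ x : M, 0 < g.scalarCurvature x → ∀ v : TangentSpace (𝓡 4) x,
        3 * g.sigma2WeylSchouten x / g.scalarCurvature x * g.val x v v ≤ g.ricci x v v) :
    ExistRicPos := by
  intro M _ _ _ _ _ e
  -- a homotopy 4-sphere is compact (Hatcher 3.29, proved in the tree) and path connected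
  haveI : CompactSpace M := compactSpace_of_homotopyEquiv_sphere_four_holds M e
  haveI : PathConnectedSpace 𝕊⁴ := pathConnectedSpace_sphere_four
  haveI : PathConnectedSpace M := pathConnectedSpace_of_homotopyEquiv e
  -- stub 1: a PSC metric with positive total σ₂-curvature
  obtain ⟨g, hLC, hg, hscal, hσ⟩ := h₁ M e
  -- stub 2: Chang–Gursky–Yang's conformal metric with `R' > 0`, `σ₂(A') > 0` pointwise
  obtain ⟨g', hLC', hg', _hconf, hscal', hσ'⟩ := h₂ M g hg hscal hσ
  refine ⟨g', hLC', hg', fun x v hv => ?_⟩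
  -- stub 3: `Ric'(v,v) ≥ 3σ₂(A')/R' · g'(v,v)`, and the right-hand side is positive
  have hR : 0 < g'.scalarCurvature x := hscal' x
  have hS : 0 < g'.sigma2WeylSchouten x := hσ' x
  have hvv : 0 < g'.val x v v := hg' x v hv
  have hkey : 3 * g'.sigma2WeylSchouten x / g'.scalarCurvature x * g'.val x v v ≤ g'.ricci x v v :=
    h₃ M g' hg' x hR v
  have hpos : 0 < 3 * g'.sigma2WeylSchouten x / g'.scalarCurvature x * g'.val x v v :=
    mul_pos (div_pos (mul_pos three_pos hS) hR) hvv
  exact lt_of_lt_of_le hpos hkey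

/-- **THE SKELETON THEOREM.** The crux
`Summit.SmoothPoincare4.SmoothPoincare4.Theses.InstantonEntropy.ExistRicPos`, concluded BY NAME
from the three DECLARED stubs `stub_sigma2BudgetPsc`, `stub_changGurskyYangThmA`,
`stub_ricciLowerBound` (the only `sorry`s of the file) through the sorry-free composition
`ExistRicPos_of_stubSigs`. [cite: ChangGurskyYang2002, Cor. B] -/
theorem ExistRicPos_of : ExistRicPos :=
  ExistRicPos_of_stubSigs stub_sigma2BudgetPsc stub_changGurskyYangThmA stub_ricciLowerBound

end Summit.SmoothPoincare4.SmoothPoincare4.Cruxes.ExistRicPos.Birth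

end
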